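import Summits.QuantumFields.YangMills.Theorems.IR.CollarDecouplingNest

/-!
# Crux `IR` (item stmt-QuantumFields-19354) — line «maximal correlation at one physical thickness»:
REDUCTION of the strong-coupling rung `ShellRung` to an adjacent-layers maximal-correlation bound

Helper module for item `stmt-QuantumFields-19354` (`--supports … --as helper`; it closes nothing; lead prover
ym-ir-line-mxc-p1).  Partial work on the registered stub `ShellMaxCorr.stub_shellRung : ShellRung`
(`Theorems/IR/ShellMaxCorrDefs.lean`), which stays OPEN: this file peels the bulk off both sides of the shell bound at
thickness one, leaving as the only missing input an `R`-uniform bound on the maximal correlation between the two ADJACENT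
SPHERE LAYERS `σ(S_R)`, `σ(S_{R+1})` of the torus Wilson state at small `|β|` (a ρ-mixing statement uniform in the set sizes,
for which the lead found no published theorem: the classical high-temperature covariance estimates — Künsch 1982, Föllmer
1982, Martinelli's `SMT(V,n,α)` — carry oscillation norms or volume factors `|Λ_f||Λ_g|`, not `σ(f)σ(g)`).

* §1 `plaquette_layer_inner`, `exists_inner_layer_version` — mirror image of `ShellMaxCorrMarkov.exists_layer_version`: for
  bounded measurable `f` reading only links of the closed ball `B_t` there is a layer-measurable bounded `f'` (a version of
  `E_μ[f | links outside the open ball]`) with `∫ f g = ∫ f' g` for every bounded measurable `g` reading only links outside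
  the open ball (DLR kernel of the volume `{links not outside}`; a plaquette meeting it has all vertices at distance `≤ t`).
* §2 `abs_cov_le_sqrt_var` (Cauchy–Schwarz for Mathlib `cov`/`Var` of bounded observables), `sqrt_var_version_le` (a layer
  version does not increase the standard deviation: `Var f' = Cov(f', f) ≤ σ(f')σ(f)`), `shellCorrBound_one_of_layers`
  (adjacent-layers bound `≤ θ` ⇒ `ShellCorrBound ρ β N R 1 θ`), `shellRung_of_layers` (the same for all `G, ρ, |β| ≤ β₀, S, R`
  with `θ = 1/2` ⇒ `ShellRung`).

HONEST FRAMING: a reduction, not a proof, of the BC5 rung of a CONDITIONAL rung line; `ShellRung` and the loads stay open; no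
mass-gap claim.

Refs: Künsch, Comm. Math. Phys. 84 (1982) 207; Föllmer, J. Funct. Anal. 46 (1982) 387; Martinelli, Saint-Flour 1997
(LNM 1717) §2.4; Bradley, Probab. Surveys 2 (2005) (ρ*-mixing).
-/

set_option autoImplicit false

noncomputable section

open Filter Topology MeasureTheory ProbabilityTheory
open Literature.MathematicalPhysics.QuantumFieldTheory Literature.MathematicalPhysics.QuantumLattice
open Literature.Probability.LatticeModels (gibbsSpecOfPotential IsGibbsMeasure
  isSpecification_gibbsSpecOfPotential)
open Summit.QuantumFields.YangMills.Cruxes.IR.CollarDecoupling (sq_corr_le_var_mul_var)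

namespace Summit.QuantumFields.YangMills.Cruxes.IR.ShellMaxCorr

/-! ## §1 Mirror plaquette geometry and the inner Markov property (inside given outside) -/

section Mirror

variable {G : Type} [Group G] [TopologicalSpace G] [IsTopologicalGroup G] [CompactSpace G]
  [MeasurableSpace G] [BorelSpace G]

omit [Group G] [TopologicalSpace G] [IsTopologicalGroup G] [CompactSpace G] [MeasurableSpace G] [BorelSpace G] in
/-- **Mirror plaquette geometry.**  For a plaquette `(y; i, j)` with `i ≠ j`: if one of its links is not outside the open
ball of radius `t` (an endpoint at distance `< t`), then every link of it which is outside lies in the sphere layer (it is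
also in `B_t`). -/
theorem plaquette_layer_inner {N : ℕ} [NeZero N] (t : ℕ) (y : Site 4 N) {i j : Fin 4} (hij : i ≠ j)
    (e₀ e : Edge 4 N)
    (he₀ : e₀ ∈ ({(y, i), (y.shift i, j), (y.shift j, i), (y, j)} : Finset (Edge 4 N)))
    (he : e ∈ ({(y, i), (y.shift i, j), (y.shift j, i), (y, j)} : Finset (Edge 4 N)))
    (h₀ : ¬ OutBall t e₀) : ¬ OutBall t e ∨ (InBall t e ∧ OutBall t e) := by
  have h1 := siteNorm_shift_le y i
  have h2 := siteNorm_shift_le y j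
  have h3 := siteNorm_le_shift y i
  have h4 := siteNorm_le_shift y j
  have h5 := siteNorm_shift_le_shift y i j
  have h6 := siteNorm_shift_le_shift y j i
  have h7 := siteNorm_le_shift_shift y hij
  have h8 := siteNorm_shift_shift_le y hij
  have h9 := siteNorm_shift_le (y.shift i) j
  have h10 := siteNorm_le_shift (y.shift i) j
  have h11 := siteNorm_shift_le (y.shift j) i
  have h12 := siteNorm_le_shift (y.shift j) i
  have hcomm : (y.shift j).shift i = (y.shift i).shift j := (shift_shift_comm y i j).symm
  rw [hcomm] at h11 h12
  simp only [Finset.mem_insert, Finset.mem_singleton] at he₀ he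
  rcases he₀ with rfl | rfl | rfl | rfl <;> rcases he with rfl | rfl | rfl | rfl <;>
    simp only [InBall, OutBall, hcomm] at h₀ ⊢ <;> omega

/-- **Inner Markov property of the torus Wilson state, in integrated form** (mirror image of `exists_layer_version`).
For every bounded measurable `f` depending only on the links of the closed ball `B_t` there is a bounded measurable `f'`
depending only on the links of the sphere layer `{InBall t ∧ OutBall t}` (a version of `E_μ[f | links outside the open
ball]`) with `∫ f g dμ = ∫ f' g dμ` for every bounded measurable `g` depending only on the links outside the open ball of
radius `t`. -/
theorem exists_inner_layer_version [T2Space G] [SecondCountableTopology G] {n : ℕ}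
    (ρ : G →* Matrix (Fin n) (Fin n) ℂ) (hρ : Continuous ρ) (β : ℝ) (N : ℕ) [NeZero N] (t : ℕ)
    {f : GaugeConfig 4 N G → ℝ} (hfm : Measurable f) {C : ℝ} (hfC : ∀ U, |f U| ≤ C)
    (hf : DependsOn f {e | InBall t e}) :
    ∃ f' : GaugeConfig 4 N G → ℝ, Measurable f' ∧ (∀ U, |f' U| ≤ C) ∧
      DependsOn f' {e | InBall t e ∧ OutBall t e} ∧
      ∀ g : GaugeConfig 4 N G → ℝ, Measurable g → (∃ Cg, ∀ U, |g U| ≤ Cg) → DependsOn g {e | OutBall t e} →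
        ∫ U, f U * g U ∂(wilsonMeasure (d := 4) (L := N) ρ β) =
          ∫ U, f' U * g U ∂(wilsonMeasure (d := 4) (L := N) ρ β) := by
  classical
  set μ : Measure (GaugeConfig 4 N G) := wilsonMeasure (d := 4) (L := N) ρ β with hμ
  haveI : IsProbabilityMeasure μ := isProbabilityMeasure_wilsonMeasure (d := 4) (L := N) ρ hρ β
  obtain ⟨Φ, supp, hΦ, hΦb, hsupp, hH, hstruct⟩ := exists_plaquettePotential (d := 4) (L := N) ρ hρ
  have hGibbs : IsGibbsMeasure (gibbsSpecOfPotential (haarProbability G) Φ supp β) μ :=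
    isGibbsMeasure_wilsonMeasure ρ hρ hΦ hΦb hsupp hH β
  have hγ := isSpecification_gibbsSpecOfPotential (haarProbability G) hΦ hΦb hsupp β
  -- the volume: links NOT outside the open ball; the layer
  set Λ : Finset (Edge 4 N) := Finset.univ.filter fun e => ¬ OutBall t e with hΛ
  set T : Set (Edge 4 N) := {e | InBall t e ∧ OutBall t e} with hT
  have hΛc : ((↑Λ : Set (Edge 4 N))ᶜ) = {e | OutBall t e} := by
    ext e; simp [hΛ]
  have hmemΛ : ∀ e, e ∈ Λ ↔ ¬ OutBall t e := fun e => by simp [hΛ]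
  have hTgeo : ∀ A ∈ supp Λ, (A ∩ Λ).Nonempty → (↑A : Set (Edge 4 N)) ⊆ ↑Λ ∪ T := by
    intro A hA hne
    obtain ⟨y, i, j, hij, rfl⟩ := hstruct Λ A hA
    obtain ⟨e₀, he₀⟩ := hne
    rw [Finset.mem_inter] at he₀
    intro e he
    have h := plaquette_layer_inner t y (ne_of_lt hij) e₀ e he₀.1 (Finset.mem_coe.1 he) ((hmemΛ e₀).1 he₀.2)
    rcases h with h | h
    · exact Or.inl (Finset.mem_coe.2 ((hmemΛ e).2 h))
    · exact Or.inr h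
  have hfdep : DependsOn f (↑Λ ∪ T) := by
    refine hf.mono fun e he => ?_
    by_cases hout : OutBall t e
    · exact Or.inr ⟨he, hout⟩
    · exact Or.inl (Finset.mem_coe.2 ((hmemΛ e).2 hout))
  obtain ⟨hwm, hwae⟩ := stronglyMeasurable_and_ae_eq_condExp_integral_gibbsSpecOfPotential
    (haarProbability G) hΦ hΦb hsupp β hGibbs Λ hTgeo hfm hfC hfdep
  set w : GaugeConfig 4 N G → ℝ := fun η => ∫ σ, f σ ∂(gibbsSpecOfPotential (haarProbability G) Φ supp β Λ η)
    with hw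
  have hwb : ∀ η, |w η| ≤ C := by
    intro η
    haveI := hγ.isProbability Λ η
    have := norm_integral_le_of_norm_le_const
      (μ := gibbsSpecOfPotential (haarProbability G) Φ supp β Λ η) (f := f) (C := C)
      (ae_of_all _ fun σ => by rw [Real.norm_eq_abs]; exact hfC σ)
    simpa only [probReal_univ, mul_one, Real.norm_eq_abs] using this
  refine ⟨w, (hwm.mono cylinderEvents_le_pi).measurable, hwb,
    dependsOn_of_measurable_cylinderEvents_real hwm.measurable, ?_⟩
  intro g hgm ⟨Cg, hgC⟩ hg
  have hgm' : StronglyMeasurable[cylinderEvents (X := fun _ : Edge 4 N => G) ((↑Λ : Set (Edge 4 N))ᶜ)] g := by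
    rw [hΛc]
    exact (hgm.measurable_cylinderEvents_of_dependsOn hg).stronglyMeasurable
  have hfi : Integrable f μ := Integrable.of_bound hfm.aestronglyMeasurable C
    (ae_of_all _ fun U => by rw [Real.norm_eq_abs]; exact hfC U)
  have hgi : Integrable g μ := Integrable.of_bound hgm.aestronglyMeasurable Cg
    (ae_of_all _ fun U => by rw [Real.norm_eq_abs]; exact hgC U)
  have hgfi : Integrable (g * f) μ := by
    refine Integrable.of_bound (hgm.mul hfm).aestronglyMeasurable (Cg * C) (ae_of_all _ fun U => ?_)
    rw [Real.norm_eq_abs, Pi.mul_apply, abs_mul]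
    exact mul_le_mul (hgC U) (hfC U) (abs_nonneg _) ((abs_nonneg _).trans (hgC U))
  have h1 : μ[g * f | cylinderEvents (X := fun _ : Edge 4 N => G) ((↑Λ : Set (Edge 4 N))ᶜ)] =ᵐ[μ]
      g * μ[f | cylinderEvents (X := fun _ : Edge 4 N => G) ((↑Λ : Set (Edge 4 N))ᶜ)] :=
    condExp_mul_of_stronglyMeasurable_left hgm' hgfi hfi
  calc ∫ U, f U * g U ∂μ
      = ∫ U, g U * f U ∂μ := by simp_rw [mul_comm]
    _ = ∫ U, (μ[g * f | cylinderEvents (X := fun _ : Edge 4 N => G) ((↑Λ : Set (Edge 4 N))ᶜ)]) U ∂μ :=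
        (integral_condExp cylinderEvents_le_pi).symm
    _ = ∫ U, g U * (μ[f | cylinderEvents (X := fun _ : Edge 4 N => G) ((↑Λ : Set (Edge 4 N))ᶜ)]) U ∂μ :=
        integral_congr_ae (h1.mono fun U hU => by simpa using hU)
    _ = ∫ U, g U * w U ∂μ := by
        refine integral_congr_ae ?_
        filter_upwards [hwae] with U hU
        rw [← hU]
    _ = ∫ U, w U * g U ∂μ := by simp_rw [mul_comm]

end Mirror

/-! ## §2 Reduction of the shell bound at thickness one to the two adjacent sphere layers -/

section CovTools

variable {G : Type} [MeasurableSpace G]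

/-- **Cauchy–Schwarz for the covariance** of bounded measurable observables: `|Cov(f,g)| ≤ σ(f) σ(g)`. -/
theorem abs_cov_le_sqrt_var {N : ℕ} (μ : Measure (GaugeConfig 4 N G)) [IsProbabilityMeasure μ]
    {f g : GaugeConfig 4 N G → ℝ} (hfm : Measurable f) (hgm : Measurable g) {Cf Cg : ℝ}
    (hfC : ∀ U, |f U| ≤ Cf) (hgC : ∀ U, |g U| ≤ Cg) :
    |cov[f, g; μ]| ≤ Real.sqrt (Var[f; μ]) * Real.sqrt (Var[g; μ]) := by
  rw [cov_eq_integral μ hfm hfC hgm hgC, variance_eq_integral hfm.aemeasurable,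
    variance_eq_integral hgm.aemeasurable,
    ← Real.sqrt_mul (integral_nonneg fun U => sq_nonneg _)]
  exact Real.abs_le_sqrt (sq_corr_le_var_mul_var μ hfm hgm hfC hgC)

/-- From `a² ≤ a b` with `a, b ≥ 0` conclude `a ≤ b`. -/
theorem le_of_sq_le_mul {a b : ℝ} (ha : 0 ≤ a) (hb : 0 ≤ b) (h : a ^ 2 ≤ a * b) : a ≤ b := by
  rcases ha.lt_or_eq with hpos | hzero
  · exact le_of_mul_le_mul_left (by nlinarith) hpos
  · rw [← hzero]; exact hb

/-- **A version contracts the standard deviation**: if `∫ f' f = ∫ f' f'` and `∫ f' = ∫ f` then `σ(f') ≤ σ(f)`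
(`Var f' = Cov(f', f) ≤ σ(f') σ(f)`). -/
theorem sqrt_var_version_le {N : ℕ} (μ : Measure (GaugeConfig 4 N G)) [IsProbabilityMeasure μ]
    {f f' : GaugeConfig 4 N G → ℝ} (hfm : Measurable f) (hf'm : Measurable f') {Cf Cf' : ℝ}
    (hfC : ∀ U, |f U| ≤ Cf) (hf'C : ∀ U, |f' U| ≤ Cf')
    (hsq : ∫ U, f' U * f U ∂μ = ∫ U, f' U * f' U ∂μ) (hmean : ∫ U, f' U ∂μ = ∫ U, f U ∂μ) :
    Real.sqrt (Var[f'; μ]) ≤ Real.sqrt (Var[f; μ]) := by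
  have hvar : Var[f'; μ] = cov[f', f; μ] := by
    rw [variance_eq_cov μ hf'm, cov_eq_integral μ hf'm hf'C hf'm hf'C, cov_eq_integral μ hf'm hf'C hfm hfC,
      hsq, hmean]
  have hcs := abs_cov_le_sqrt_var μ hf'm hfm hf'C hfC
  refine le_of_sq_le_mul (Real.sqrt_nonneg _) (Real.sqrt_nonneg _) ?_
  rw [Real.sq_sqrt (variance_nonneg _ _)]
  exact hvar.le.trans ((le_abs_self _).trans hcs)

end CovTools

section Reduce

variable {G : Type} [Group G] [TopologicalSpace G] [IsTopologicalGroup G] [CompactSpace G]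
  [MeasurableSpace G] [BorelSpace G]

/-- **Two-layer reduction of the shell bound at thickness one.**  On the torus of side `N` (compact metrisable `G`,
continuous `ρ`): if the maximal correlation between the two ADJACENT SPHERE LAYERS `σ(S_R)` and `σ(S_{R+1})`
(`S_t = {links with both endpoints at sup-distance exactly t}`) is `≤ θ`, then so is the maximal correlation between all
of `B_R` and everything outside the open ball of radius `R+1` (`ShellCorrBound ρ β N R 1 θ`): the bulk on both sides is
peeled off by the Markov property (`exists_inner_layer_version`, `exists_layer_version`), the layer versions having the same
covariance and no larger standard deviations. -/
theorem shellCorrBound_one_of_layers [T2Space G] [SecondCountableTopology G] {n : ℕ}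
    (ρ : G →* Matrix (Fin n) (Fin n) ℂ) (hρ : Continuous ρ) (β : ℝ) (N : ℕ) [NeZero N] (R : ℕ) {θ : ℝ}
    (hθ : 0 ≤ θ)
    (hpair : ∀ f g : GaugeConfig 4 N G → ℝ, Measurable f → Measurable g →
      (∃ C, ∀ U, |f U| ≤ C) → (∃ C, ∀ U, |g U| ≤ C) →
      DependsOn f {e | InBall R e ∧ OutBall R e} → DependsOn g {e | InBall (R + 1) e ∧ OutBall (R + 1) e} →
        |cov[f, g; wilsonMeasure (d := 4) (L := N) ρ β]| ≤
          θ * Real.sqrt (Var[f; wilsonMeasure (d := 4) (L := N) ρ β]) *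
            Real.sqrt (Var[g; wilsonMeasure (d := 4) (L := N) ρ β])) :
    ShellCorrBound ρ β N R 1 θ := by
  intro f g hfm hgm hfb hgb hf hg
  obtain ⟨Cf, hfC⟩ := hfb
  obtain ⟨Cg, hgC⟩ := hgb
  set μ : Measure (GaugeConfig 4 N G) := wilsonMeasure (d := 4) (L := N) ρ β with hμ
  haveI : IsProbabilityMeasure μ := isProbabilityMeasure_wilsonMeasure (d := 4) (L := N) ρ hρ β
  -- layer versions of `g` (outer, radius `R+1`) and of `f` (inner, radius `R`)
  obtain ⟨g', hg'm, hg'C, hg'dep, hgswap⟩ := exists_layer_version ρ hρ β N (R + 1) hgm hgC hg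
  obtain ⟨f', hf'm, hf'C, hf'dep, hfswap⟩ := exists_inner_layer_version ρ hρ β N R hfm hfC hf
  -- support inclusions
  have hg'outR : DependsOn g' {e | OutBall R e} := hg'dep.mono fun e he => outBall_anti (Nat.le_succ R) he.2
  have hg'in1 : DependsOn g' {e | InBall (R + 1) e} := hg'dep.mono fun e he => he.1
  have hf'outR : DependsOn f' {e | OutBall R e} := hf'dep.mono fun e he => he.2
  have hfin1 : DependsOn f {e | InBall (R + 1) e} := hf.mono fun e he => inBall_mono (Nat.le_succ R) he
  have h1dep : ∀ t : ℕ, DependsOn (fun _ : GaugeConfig 4 N G => (1 : ℝ)) {e | InBall t e} := fun t =>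
    (dependsOn_const (1 : ℝ)).mono (Set.empty_subset _)
  have h1dep' : ∀ t : ℕ, DependsOn (fun _ : GaugeConfig 4 N G => (1 : ℝ)) {e | OutBall t e} := fun t =>
    (dependsOn_const (1 : ℝ)).mono (Set.empty_subset _)
  -- integral identities
  have e1 : ∫ U, f U * g U ∂μ = ∫ U, f U * g' U ∂μ := hgswap f hfm ⟨Cf, hfC⟩ hfin1
  have e2 : ∫ U, g U ∂μ = ∫ U, g' U ∂μ := by
    simpa only [one_mul] using hgswap (fun _ => (1 : ℝ)) measurable_const ⟨1, fun _ => by simp⟩ (h1dep (R + 1))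
  have e3 : ∫ U, f U * g' U ∂μ = ∫ U, f' U * g' U ∂μ := hfswap g' hg'm ⟨Cg, hg'C⟩ hg'outR
  have e4 : ∫ U, f U ∂μ = ∫ U, f' U ∂μ := by
    simpa only [mul_one] using hfswap (fun _ => (1 : ℝ)) measurable_const ⟨1, fun _ => by simp⟩ (h1dep' R)
  have e5 : ∫ U, g' U * g U ∂μ = ∫ U, g' U * g' U ∂μ := hgswap g' hg'm ⟨Cg, hg'C⟩ hg'in1
  have e6 : ∫ U, f U * f' U ∂μ = ∫ U, f' U * f' U ∂μ := hfswap f' hf'm ⟨Cf, hf'C⟩ hf'outR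
  -- covariances
  have hcov : cov[f, g; μ] = cov[f', g'; μ] := by
    rw [cov_eq_integral μ hfm hfC hgm hgC, cov_eq_integral μ hf'm hf'C hg'm hg'C, e1, e2, e3, e4]
  have hσg : Real.sqrt (Var[g'; μ]) ≤ Real.sqrt (Var[g; μ]) :=
    sqrt_var_version_le μ hgm hg'm hgC hg'C e5 e2.symm
  have hσf : Real.sqrt (Var[f'; μ]) ≤ Real.sqrt (Var[f; μ]) := by
    refine sqrt_var_version_le μ hfm hf'm hfC hf'C ?_ e4.symm
    have e6' : ∫ U, f' U * f U ∂μ = ∫ U, f U * f' U ∂μ := by simp_rw [mul_comm]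
    rw [e6', e6]
  have hkey := hpair f' g' hf'm hg'm ⟨Cf, hf'C⟩ ⟨Cg, hg'C⟩ hf'dep hg'dep
  calc |cov[f, g; μ]| = |cov[f', g'; μ]| := by rw [hcov]
    _ ≤ θ * Real.sqrt (Var[f'; μ]) * Real.sqrt (Var[g'; μ]) := hkey
    _ ≤ θ * Real.sqrt (Var[f; μ]) * Real.sqrt (Var[g; μ]) := by gcongr

/-- **`ShellRung` reduces to the adjacent-layers bound.**  If for every compact metrisable `G` and continuous `ρ` there is
`β₀ > 0` such that for `|β| ≤ β₀`, on every odd torus and for every radius `R`, the maximal correlation between the sphere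
layers `σ(S_R)` and `σ(S_{R+1})` of the torus Wilson state is `≤ 1/2`, then `ShellRung` holds.  (This isolates the genuinely
open input of the rung: an `R`-uniform ρ-mixing bound between two adjacent layers at high temperature.) -/
theorem shellRung_of_layers
    (h : ∀ (G : Type) [Group G] [TopologicalSpace G] [IsTopologicalGroup G] [CompactSpace G] [T2Space G]
      [SecondCountableTopology G] [MeasurableSpace G] [BorelSpace G] (n : ℕ) (ρ : G →* Matrix (Fin n) (Fin n) ℂ),
      Continuous ρ → ∃ β₀ : ℝ, 0 < β₀ ∧ ∀ β : ℝ, |β| ≤ β₀ → ∀ S R : ℕ,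
        ∀ f g : GaugeConfig 4 (2 * S + 1) G → ℝ, Measurable f → Measurable g →
          (∃ C, ∀ U, |f U| ≤ C) → (∃ C, ∀ U, |g U| ≤ C) →
          DependsOn f {e | InBall R e ∧ OutBall R e} → DependsOn g {e | InBall (R + 1) e ∧ OutBall (R + 1) e} →
            |cov[f, g; wilsonMeasure (d := 4) (L := 2 * S + 1) ρ β]| ≤
              1 / 2 * Real.sqrt (Var[f; wilsonMeasure (d := 4) (L := 2 * S + 1) ρ β]) *
                Real.sqrt (Var[g; wilsonMeasure (d := 4) (L := 2 * S + 1) ρ β])) :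
    ShellRung := by
  intro G _ _ _ _ _ _ _ _ n ρ hρ
  obtain ⟨β₀, hβ₀, hb⟩ := h G n ρ hρ
  refine ⟨β₀, hβ₀, fun β hβ S R => ?_⟩
  exact shellCorrBound_one_of_layers ρ hρ β (2 * S + 1) R (by norm_num) (hb β hβ S R)

end Reduce

end Summit.QuantumFields.YangMills.Cruxes.IR.ShellMaxCorr

end
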